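import Mathlib
import HarnessLib
import Summits.HubbardSuperconductivity.HubbardSuperconductivity.Theorems.KLProgrammeKLRegimeEngineTowerLevReadoutFitFBornSharp

/-!
# Route `KLProgramme` — crux K3 ENGINE (stmt-HubbardSuperconductivity-20437 `KLRegimeEngineV17F2`), stub (b) v2, THE LEVELS PACKAGE (ℓ), located item
# «(ℓ)-READOUT-F», (R332)(D)(α′) RO-3′: THE READ-OUT OF A LEVEL `j ≥ 1` FROM THE LEVEL-`0` DATUM AND THE BLOCK-`0` STEP — below `KernelNormsLevels`'
# right-hand side, sharp envelope (cell gate-hubbard-kl, seat gate-hubbard-kl-p3 g22; block-`0` twin of k3c3-p2 g16's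
# `readoutLevF_le_levelsRHS_of_bornRows_sharp` (…TowerLevReadoutFitFBornSharp, p692047) — NO tower law: the re-measured part is ONE floor jump of the
# level-`0` datum `𝒱_1 @ F_0` to `F_j`)

WHY.  (R332)(C) lists «grid rows at `(Λ_j, F_j)`, `j < d`» among the inputs of the levels package on `K_n`: RO-3 (`kernelNormsLevels_uvF_of_wgridStep`) reads
each level `j < d` by its own UV step.  (α′) reads them instead from the LEVEL-`0` datum and ONE thick block `(Λ_j, Λ_1]`: `𝒱_j = 𝒱_1 + (𝒱_j − 𝒱_1)` with
`𝒱_1 = klTowerInput … 1 1` measured at `F_0` (base rows `Nb` and their floor-unit law at `J = 0`; Chernoff rows of the floor array `klTowerMuLevF … 1 1 m`)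
and the increment born at `F_1` by the block-`0` kit step (`partialIncrLevF_le_kitStep_of_bounds'` at `(d,k) := (1,1)` / `blockZeroIncrLevF_le_kitStep_klEng`,
…TowerPartialIncrLevStepFOne / …TowerBlockZeroIncrLevStepFKlEng), both read at `F_j` by the floor jump `floorJump_readout_le` (`J + 1 ≤ J′`; at `j = 1` the
increment vanishes and the base jump is `F_0 → F_1`).  The fit `towerReadout_le_of_ro_mul`, the sharp bracket `readoutBracket_le_law_mul_sharp` and the
units row `readoutLev_le_levelsRHS` are those of RO-4‴♯ verbatim; the re-measured profile is `A_ro = C_inc·A_b`, `Q_ro = D_inc·Q_b` (one jump, no blocks).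

* **`readoutLevF_le_levelsRHS_blockZero_sharp`** — `∃ C_inc > 0, D_inc ≥ 1` and thresholds such that, for every `FrameOK` frame `K`, every `1 ≤ j ≤ n_β + 1`,
  cap `D ≥ 3`, `B ≥ 1`, the level-`0` datum rows at `λ = B·ε_j`, the Chernoff/import rows of `klTowerMuLevF … 1 1`, the five smallness rows, the block-`0`
  born step at `F_1` in kit form, the read-out constants (equational) and the `CE` threshold: for `3 ≤ p ≤ D`, `7 ≤ 2p + t`, every prescription `Ωe` of
  level `t + 1` at `F_j`, `klLevNormOf … j (2p) 𝒱_j Ωe ≤ CE^p·ε_j^{p−1}·2^{(3p−5)j}·((2^j)⁻¹)^{levelGainExp (t+1)}`.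
Compositions of landed theorems and real algebra; nothing about the model is asserted beyond them; nothing asserts (ℓ), any stub, K3 or superconductivity.
References: BGM 2006 §2.8 (2.82)–(2.84), (2.93)–(2.98), Lemma 2.5 (2.98) [cite: BenfattoGiulianiMastropietro2006].
-/

noncomputable section

namespace Summit.HubbardSuperconductivity.HubbardSuperconductivity.Theorems.EngineV8

set_option linter.dupNamespace false -- summit = problem name (single-conjunct summit), D-0017

open Classical
open Real Finset Literature.MathematicalPhysics.QuantumLattice Literature.Probability.LatticeModels GrassmannAlgebra
open Literature.MathematicalPhysics.QuantumLattice.FermiRG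
open Summit.HubbardSuperconductivity.HubbardSuperconductivity.Theorems.KLProgrammeLegKernels
open Summit.HubbardSuperconductivity.HubbardSuperconductivity.Theorems.KLRegimeSplit
open Summit.HubbardSuperconductivity.HubbardSuperconductivity.Theorems.KLRegimeWick
open Summit.HubbardSuperconductivity.HubbardSuperconductivity.Theorems.TorusFourierL2
open Summit.HubbardSuperconductivity.HubbardSuperconductivity.Theorems.DispersionFlow
open Summit.HubbardSuperconductivity.HubbardSuperconductivity.Theorems.PerturbedFermiCurve

variable {L M : ℕ} [NeZero L] [NeZero M]

/-! ## The block-`0` read-out, sharp envelope -/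

omit [NeZero L] [NeZero M] in
/-- **THE READ-OUT AT ANY LEVEL `1 ≤ j` FROM THE LEVEL-`0` DATUM, WITH THE BLOCK-`0` STEP BORN AT `F_1` — SHARP ENVELOPE** ((α′) RO-3′; the block-`0`
twin of `readoutLevF_le_levelsRHS_of_bornRows_sharp`: its base datum is `𝒱_1 = klTowerInput … 1 1` at `F_0`, there is NO law binder, the Chernoff / import /
smallness / born-step rows are those of the floor array `klTowerMuLevF … 1 1` and of the increment `𝒱_j − 𝒱_1` at `F_1`, and the re-measured profile is
`A_ro = C_inc·A_b`, `Q_ro = D_inc·Q_b`).  See the module docstring.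
[cite: BenfattoGiulianiMastropietro2006, §2.8 (2.82)-(2.84), (2.93)-(2.98), Lemma 2.5 (2.98)] -/
theorem readoutLevF_le_levelsRHS_blockZero_sharp :
    ∃ Cinc Dinc : ℝ, 0 < Cinc ∧ 1 ≤ Dinc ∧ ∀ R : RenConsts, R.WF2 → ∃ c₃' : ℝ, 0 < c₃' ∧ ∃ U₀' : ℝ, 0 < U₀' ∧
      ∀ (P : SplitConsts) (c : ℝ), P.WF → 0 < c → c ≤ klEngC₃6 P R → c ≤ c₃' →
      ∀ μ ∈ klWindowC, ∀ U : ℝ, 0 < U → U ≤ klEngU₀9 P R c → U ≤ U₀' → ∀ β : ℝ, klBetaMin ≤ β → β ≤ Real.exp (c / U ^ 2) →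
      ∀ K : TrigPolyC4v, FrameOK R U (nScales β) μ K → ∀ (L M : ℕ) [NeZero L] [NeZero M],
      klEngL₃ β U ≤ L → klEngM₃ β U L ≤ M → ∀ j D : ℕ, 1 ≤ j → j ≤ nScales β + 1 → 3 ≤ D →
      ∀ (B Ab Qb : ℝ), 1 ≤ B → 0 ≤ Ab → 0 ≤ Qb →
      -- the level-`0` datum: `𝒱_1` at `F_0` and its unit law at `J = 0`, at `λ = B·ε_j`
      ∀ Nb : Fin 5 → ℕ → ℝ, (∀ t p, 0 ≤ Nb t p) →
        (∀ (t : Fin 5) (p : ℕ) (Ωe' : Fin (2 * p) → Option (SectorLeg (sectorCount 0))), levelCount Ωe' = (t : ℕ) + 1 →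
          klLevNormOf L M β μ K 0 (2 * p) (klTowerInput L M β U μ K 1 1) Ωe' ≤ Nb t p) →
        (∀ (t : Fin 5) (p : ℕ), 3 ≤ p → Nb t p / klLevUnitF β M t p 0 ≤ Ab * (B * epsCoupling P U j) ^ (p - 1) * Qb ^ p) →
      ∀ (W Z σ Φ ψ τ A' Q' ι₁ ι₂ ι₃ : ℝ), 0 < W → 0 < Z → 0 ≤ σ → 0 ≤ Φ → 0 ≤ ψ → 0 < τ → 0 ≤ A' → 0 < Q' →
      -- the Chernoff data of the level-`0` datum in floor units (`klTowerMuLevF … 1 1`) and the imports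
      (∀ m, 4 ≤ m → m ≤ D → W * Z ^ m * klTowerMuLevF L M β U μ K 1 1 m ≤ A' * (B * epsCoupling P U j) ^ (m - 1) * Q' ^ m) →
      W * Z ^ 3 * klTowerMuLevF L M β U μ K 1 1 3 ≤ ι₃ * (B * epsCoupling P U j) ^ 2 →
      W * Z ^ 1 * klTowerMuLevF L M β U μ K 1 1 1 ≤ ι₁ * (B * epsCoupling P U j) →
      W * Z ^ 2 * klTowerMuLevF L M β U μ K 1 1 2 ≤ ι₂ * (B * epsCoupling P U j) →
      -- the five smallness rows at `(A′, Q′, λ)`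
      4 * σ * (B * epsCoupling P U j) * Q' < 1 → 2 * (B * epsCoupling P U j) * τ * Q' ≤ 1 → exp 1 * τ * (B * epsCoupling P U j) * Q' < 1 →
      Φ * (τ * (ι₁ * (B * epsCoupling P U j) + ι₂ / (2 * Q') + ι₃ / (4 * Q' ^ 2) + A' * Q' / 4)) < 1 →
      Φ * (exp 1 * τ * (ι₁ * (B * epsCoupling P U j)) + (exp 1 * τ) ^ 2 * (ι₂ * (B * epsCoupling P U j)) +
          (exp 1 * τ) ^ 3 * (ι₃ * (B * epsCoupling P U j) ^ 2) +
        A' * (exp 1 * τ * Q') * ((exp 1 * τ * (B * epsCoupling P U j) * Q') ^ 3 / (1 - exp 1 * τ * (B * epsCoupling P U j) * Q'))) < 1 →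
      -- the block-`0` step BORN AT `F_1` (the tail of `blockZeroIncrLevF_le_kitStep_klEng` / `partialIncrLevF_le_kitStep_of_bounds'` at `(1,1)`, verbatim shape)
      (∀ N : ℕ, 1 ≤ N → Φ * towerV D τ (fun m => W * Z ^ m * klTowerMuLevF L M β U μ K 1 1 m) < 1 →
        ∀ (t : Fin 5) (q : ℕ) (Ωe : Fin (2 * q + 1 + 1) → Option (SectorLeg (sectorCount 1))), levelCount Ωe = (t : ℕ) + 1 →
        klLevNormOf L M β μ K 1 (2 * q + 1 + 1) (klEffectiveAction L M β U μ K klE0 j - klTowerInput L M β U μ K 1 1) Ωe /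
            klLevUnitF β M t (q + 1) 1 ≤
          towerFO D σ (fun m => W * Z ^ m * klTowerMuLevF L M β U μ K 1 1 m) (q + 1) +
            ∑ n' ∈ Icc 2 N, exp 1 * Φ ^ (n' - 1) * ψ ^ (q + 1) * towerS D τ (fun m => W * Z ^ m * klTowerMuLevF L M β U μ K 1 1 m) n' (q + 1) +
            ψ ^ (q + 1) * exp 1 * towerV D τ (fun m => W * Z ^ m * klTowerMuLevF L M β U μ K 1 1 m) *
              (Φ * towerV D τ (fun m => W * Z ^ m * klTowerMuLevF L M β U μ K 1 1 m)) ^ N /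
              (1 - Φ * towerV D τ (fun m => W * Z ^ m * klTowerMuLevF L M β U μ K 1 1 m))) →
      -- the read-out constants (equational binders) and the threshold
      ∀ (Aro Qro Qtot Atot : ℝ), Aro = Cinc * Ab → Qro = Dinc * Qb → Qtot = Dinc * max 1 (max Qro (max (4 * Q') (2 * τ * ψ * Q'))) →
        Atot = Aro + Cinc * (A' * (4 * σ * (B * epsCoupling P U j) * Q' / (1 - 4 * σ * (B * epsCoupling P U j) * Q')) +
          exp 1 * (τ * (ι₁ * (B * epsCoupling P U j) + ι₂ / (2 * Q') + ι₃ / (4 * Q' ^ 2) + A' * Q' / 4)) *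
            (Φ * (τ * (ι₁ * (B * epsCoupling P U j) + ι₂ / (2 * Q') + ι₃ / (4 * Q' ^ 2) + A' * Q' / 4)) /
              (1 - Φ * (τ * (ι₁ * (B * epsCoupling P U j) + ι₂ / (2 * Q') + ι₃ / (4 * Q' ^ 2) + A' * Q' / 4)))) / (2 * τ * Q')) →
      ∀ CE : ℝ, Qtot * imagTimeWeight β M ^ 2 * B * max 1 (Atot / imagTimeWeight β M) ≤ CE →
      ∀ (t : Fin 5) (p : ℕ), 3 ≤ p → p ≤ D → 7 ≤ 2 * p + (t : ℕ) →
      ∀ Ωe : Fin (2 * p) → Option (SectorLeg (sectorCount j)), levelCount Ωe = (t : ℕ) + 1 →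
        klLevNormOf L M β μ K j (2 * p) (klEffectiveAction L M β U μ K klE0 j) Ωe ≤
          CE ^ p * epsCoupling P U j ^ (p - 1) * (2 : ℝ) ^ ((3 * (p : ℤ) - 5) * j) * (((2 : ℝ) ^ j)⁻¹) ^ levelGainExp ((t : ℕ) + 1) := by
  obtain ⟨C₁', C₂', hC₁', hC₂', hJ⟩ := floorJump_readout_le
  refine ⟨(27 : ℝ) ^ 5 * (C₁' / C₂'), max 1 (C₂' ^ 2), by positivity, le_max_left _ _, fun R hR2 => ?_⟩
  obtain ⟨c₃'', hc₃'', U₀'', hU₀'', hJ'⟩ := hJ R hR2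
  refine ⟨c₃'', hc₃'', U₀'', hU₀'', ?_⟩
  intro P c hP hc hc6 hcB μ hμ U hU hU9 hUB β hβmin hβc K hK L M _ _ hL3 hM3 j D hj1 hjN hD B Ab Qb hB hAb hQb Nb hNb0 hcar
    hlawb W Z σ Φ ψ τ A' Q' ι₁ ι₂ ι₃ hW hZ hσ hΦ hψ hτ hA'0 hQ'0 hprof hprof3 himp₁ himp₂ hx₁ hx₂ hx₃ hy hθ hborn Aro Qro Qtot Atot hAro hQro hQtot
    hAtot CE hCE t p hp hpD hpt Ωe hlev
  have hβ : 0 < β := KLRegimeSplit.pos_of_klBetaMin_le hβmin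
  have hK1 : 1 ≤ P.Klam := hP.1
  have hKl : 0 ≤ P.Klam := le_trans zero_le_one hK1
  have hε : 0 < epsCoupling P U j := by
    unfold epsCoupling
    have : 0 < |U| + U ^ 2 * (j : ℝ) := by positivity
    positivity
  have hB0 : 0 < B := lt_of_lt_of_le one_pos hB
  set lam : ℝ := B * epsCoupling P U j with hlamdef
  have hlam : 0 < lam := mul_pos hB0 hε
  have hu : 0 < klLevUnitF β M t p j := klLevUnitF_pos hβ t p j
  set μk : ℕ → ℝ := fun m => W * Z ^ m * klTowerMuLevF L M β U μ K 1 1 m with hμk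
  have hμ0 : ∀ m, 0 ≤ μk m := fun m =>
    mul_nonneg (by positivity) (klTowerMuLevF_nonneg (L := L) (M := M) hβ U μ K 1 1 m)
  have hCinc0 : 0 < (27 : ℝ) ^ 5 * (C₁' / C₂') := by positivity
  have hDinc1 : (1 : ℝ) ≤ max 1 (C₂' ^ 2) := le_max_left _ _
  have hDinc0 : (0 : ℝ) < max 1 (C₂' ^ 2) := lt_of_lt_of_le one_pos hDinc1
  have ht := t.isLt
  -- the nonnegativity of the imports from the rows
  have hι₁0 : 0 ≤ ι₁ := by
    have h1 : 0 ≤ ι₁ * lam := (hμ0 1).trans himp₁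
    rw [mul_comm] at h1
    exact nonneg_of_mul_nonneg_right h1 hlam
  have hι₂0 : 0 ≤ ι₂ := by
    have h1 : 0 ≤ ι₂ * lam := (hμ0 2).trans himp₂
    rw [mul_comm] at h1
    exact nonneg_of_mul_nonneg_right h1 hlam
  have hι₃0 : 0 ≤ ι₃ := by
    have h1 : 0 ≤ ι₃ * lam ^ 2 := (hμ0 3).trans hprof3
    rw [mul_comm] at h1
    exact nonneg_of_mul_nonneg_right h1 (by positivity)
  have hAro0 : 0 ≤ Aro := by rw [hAro]; positivity
  have hQro0 : 0 ≤ Qro := by rw [hQro]; positivity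
  -- (1) the re-measured part: the level-`0` datum `𝒱_1 @ F_0` jumped ONCE to `F_j` (`0 + 1 ≤ j`), weight `27^{t+1} ≤ 27^5`
  have hbaseW : ∀ Ωe' : Fin (2 * p) → Option (SectorLeg (sectorCount 0)), levelCount Ωe' = (t : ℕ) + 1 →
      (27 : ℝ) ^ ((t : ℕ) + 1) * klLevNormOf L M β μ K 0 (2 * p) (klTowerInput L M β U μ K 1 1) Ωe' / klLevUnitF β M t p 0 ≤
        (27 : ℝ) ^ 5 * (Ab * lam ^ (p - 1) * Qb ^ p) := by
    intro Ωe' hlev'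
    have hu0 : 0 < klLevUnitF β M t p 0 := klLevUnitF_pos hβ t p 0
    have h27 : (27 : ℝ) ^ ((t : ℕ) + 1) ≤ (27 : ℝ) ^ 5 := pow_le_pow_right₀ (by norm_num) (by omega)
    have hq : klLevNormOf L M β μ K 0 (2 * p) (klTowerInput L M β U μ K 1 1) Ωe' / klLevUnitF β M t p 0 ≤ Ab * lam ^ (p - 1) * Qb ^ p :=
      (div_le_div_of_nonneg_right (hcar t p Ωe' hlev') hu0.le).trans (hlawb t p hp)
    rw [mul_div_assoc]
    exact mul_le_mul h27 hq (div_nonneg (klLevNormOf_nonneg hβ.le μ K 0 (2 * p) _ Ωe') hu0.le) (by positivity)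
  have hro : klLevNormOf L M β μ K j (2 * p) (klTowerInput L M β U μ K 1 1) Ωe / klLevUnitF β M t p j ≤ Aro * lam ^ (p - 1) * Qro ^ p := by
    have hjmp := hJ' P c hP hc hc6 hcB μ hμ U hU hU9 hUB β hβmin hβc K hK L M hL3 hM3 0 j (by omega) hjN
      (klTowerInput L M β U μ K 1 1) (fun m' X hX => by
        unfold klTowerInput; exact klEffectiveAction_momentumConserving β U μ K klE0 (1 * 1) m' X hX) t p (by omega) hp _ (by positivity)
      hbaseW Ωe hlev
    refine hjmp.trans ?_
    rw [hAro, hQro]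
    have hsq : (C₂' ^ 2) ^ p ≤ (max 1 (C₂' ^ 2)) ^ p := pow_le_pow_left₀ (sq_nonneg _) (le_max_right _ _) _
    calc C₁' / C₂' * (C₂' ^ 2) ^ p * ((27 : ℝ) ^ 5 * (Ab * lam ^ (p - 1) * Qb ^ p))
        ≤ C₁' / C₂' * (max 1 (C₂' ^ 2)) ^ p * ((27 : ℝ) ^ 5 * (Ab * lam ^ (p - 1) * Qb ^ p)) :=
          mul_le_mul_of_nonneg_right (mul_le_mul_of_nonneg_left hsq (by positivity)) (by positivity)
      _ = (27 : ℝ) ^ 5 * (C₁' / C₂') * Ab * lam ^ (p - 1) * (max 1 (C₂' ^ 2) * Qb) ^ p := by rw [mul_pow]; ring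
  -- (2) `𝒱_j = 𝒱_1 + (𝒱_j − 𝒱_1)`: the public size is at most `ro + inc`
  have hpub : klLevNormOf L M β μ K j (2 * p) (klEffectiveAction L M β U μ K klE0 j) Ωe / klLevUnitF β M t p j ≤
      klLevNormOf L M β μ K j (2 * p) (klTowerInput L M β U μ K 1 1) Ωe / klLevUnitF β M t p j +
        klLevNormOf L M β μ K j (2 * p) (klEffectiveAction L M β U μ K klE0 j - klTowerInput L M β U μ K 1 1) Ωe / klLevUnitF β M t p j := by
    rw [← add_div]
    refine div_le_div_of_nonneg_right ?_ hu.le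
    have h := klLevNormOf_add_le hβ.le μ K j (2 * p) (klTowerInput L M β U μ K 1 1)
      (klEffectiveAction L M β U μ K klE0 j - klTowerInput L M β U μ K 1 1) Ωe
    rwa [add_sub_cancel] at h
  -- (3) the increment at `F_j` from the BORN step at `F_1`: zero at `j = 1`, the floor jump for `2 ≤ j`
  have hV0 : 0 ≤ towerV D τ μk := towerV_nonneg hτ.le hμ0
  have hkit0 : ∀ (N q : ℕ), Φ * towerV D τ μk < 1 →
      0 ≤ towerFO D σ μk q + ∑ n' ∈ Icc 2 N, exp 1 * Φ ^ (n' - 1) * ψ ^ q * towerS D τ μk n' q +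
        ψ ^ q * exp 1 * towerV D τ μk * (Φ * towerV D τ μk) ^ N / (1 - Φ * towerV D τ μk) := by
    intro N q hg
    have h1 : 0 ≤ towerFO D σ μk q := towerFO_nonneg hσ hμ0 q
    have h2 : 0 ≤ ∑ n' ∈ Icc 2 N, exp 1 * Φ ^ (n' - 1) * ψ ^ q * towerS D τ μk n' q :=
      sum_nonneg fun n' _ => by have := towerS_nonneg (D := D) hτ.le hμ0 n' q; positivity
    have h3 : 0 ≤ ψ ^ q * exp 1 * towerV D τ μk * (Φ * towerV D τ μk) ^ N / (1 - Φ * towerV D τ μk) :=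
      div_nonneg (by positivity) (sub_nonneg.2 hg.le)
    linarith
  have hincj : ∀ N : ℕ, 2 ≤ N → Φ * towerV D τ μk < 1 →
      klLevNormOf L M β μ K j (2 * p) (klEffectiveAction L M β U μ K klE0 j - klTowerInput L M β U μ K 1 1) Ωe / klLevUnitF β M t p j ≤
        (27 : ℝ) ^ 5 * (C₁' / C₂') * (max 1 (C₂' ^ 2)) ^ p * (towerFO D σ μk p + ∑ n' ∈ Icc 2 N, exp 1 * Φ ^ (n' - 1) * ψ ^ p * towerS D τ μk n' p +
          ψ ^ p * exp 1 * towerV D τ μk * (Φ * towerV D τ μk) ^ N / (1 - Φ * towerV D τ μk)) := by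
    intro N hN hg
    have hk0 := hkit0 N p hg
    by_cases hjk : 1 + 1 ≤ j
    · -- the born bound at `F_1`, weighted, then jumped to `F_j`
      obtain ⟨q, rfl⟩ : ∃ q, p = q + 1 := ⟨p - 1, by omega⟩
      have hbornW : ∀ Ωe' : Fin (2 * (q + 1)) → Option (SectorLeg (sectorCount 1)), levelCount Ωe' = (t : ℕ) + 1 →
          (27 : ℝ) ^ ((t : ℕ) + 1) * klLevNormOf L M β μ K 1 (2 * (q + 1))
              (klEffectiveAction L M β U μ K klE0 j - klTowerInput L M β U μ K 1 1) Ωe' / klLevUnitF β M t (q + 1) 1 ≤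
            (27 : ℝ) ^ ((t : ℕ) + 1) * (towerFO D σ μk (q + 1) + ∑ n' ∈ Icc 2 N, exp 1 * Φ ^ (n' - 1) * ψ ^ (q + 1) * towerS D τ μk n' (q + 1) +
              ψ ^ (q + 1) * exp 1 * towerV D τ μk * (Φ * towerV D τ μk) ^ N / (1 - Φ * towerV D τ μk)) := by
        intro Ωe' hlev'
        rw [mul_div_assoc]
        exact mul_le_mul_of_nonneg_left (hborn N (by omega) hg t q Ωe' hlev') (by positivity)
      have hjmp := hJ' P c hP hc hc6 hcB μ hμ U hU hU9 hUB β hβmin hβc K hK L M hL3 hM3 1 j hjk hjN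
        (klEffectiveAction L M β U μ K klE0 j - klTowerInput L M β U μ K 1 1) (partialIncr_momentumConserving β U μ K 1 1 j) t (q + 1)
        (by omega) hp _ (by positivity) hbornW Ωe hlev
      refine hjmp.trans ?_
      have h27 : (27 : ℝ) ^ ((t : ℕ) + 1) ≤ (27 : ℝ) ^ 5 := pow_le_pow_right₀ (by norm_num) (by omega)
      have hsq : (C₂' ^ 2) ^ (q + 1) ≤ (max 1 (C₂' ^ 2)) ^ (q + 1) := pow_le_pow_left₀ (sq_nonneg _) (le_max_right _ _) _
      calc C₁' / C₂' * (C₂' ^ 2) ^ (q + 1) * ((27 : ℝ) ^ ((t : ℕ) + 1) *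
              (towerFO D σ μk (q + 1) + ∑ n' ∈ Icc 2 N, exp 1 * Φ ^ (n' - 1) * ψ ^ (q + 1) * towerS D τ μk n' (q + 1) +
                ψ ^ (q + 1) * exp 1 * towerV D τ μk * (Φ * towerV D τ μk) ^ N / (1 - Φ * towerV D τ μk)))
          ≤ C₁' / C₂' * (max 1 (C₂' ^ 2)) ^ (q + 1) * ((27 : ℝ) ^ 5 *
              (towerFO D σ μk (q + 1) + ∑ n' ∈ Icc 2 N, exp 1 * Φ ^ (n' - 1) * ψ ^ (q + 1) * towerS D τ μk n' (q + 1) +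
                ψ ^ (q + 1) * exp 1 * towerV D τ μk * (Φ * towerV D τ μk) ^ N / (1 - Φ * towerV D τ μk))) :=
            mul_le_mul (mul_le_mul_of_nonneg_left hsq (by positivity)) (mul_le_mul_of_nonneg_right h27 hk0) (by positivity) (by positivity)
        _ = _ := by ring
    · -- `j = 1`: the increment vanishes
      have h0 : klEffectiveAction L M β U μ K klE0 j - klTowerInput L M β U μ K 1 1 = 0 := by
        rw [show j = 1 * 1 by omega]
        unfold klTowerInput
        exact sub_self _
      rw [h0, klLevNormOf_zero, zero_div]
      exact mul_nonneg (by positivity) hk0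
  -- (4) E1 part 7 with the re-measured part under its own profile and the constant on the increment
  have hfit := towerReadout_le_of_ro_mul (D := D) (μ := μk) hσ hΦ hψ hτ hlam hA'0 hQ'0 hCinc0 hDinc0 hμ0
    himp₁ himp₂ hprof3 hprof hx₁ hx₂ hx₃ hy hθ hp hpub hro hincj
  -- (5) the bracket under one law, and the levels right-hand side
  set Yl : ℝ := ι₁ * lam + ι₂ / (2 * Q') + ι₃ / (4 * Q' ^ 2) + A' * Q' / 4 with hYl
  have hYl0 : 0 ≤ Yl := by positivity
  have hTY : 0 ≤ τ * Yl := by positivity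
  have hx10 : 0 ≤ 4 * σ * lam * Q' / (1 - 4 * σ * lam * Q') := div_nonneg (by positivity) (sub_nonneg.2 hx₁.le)
  have hYy : 0 ≤ Φ * (τ * Yl) / (1 - Φ * (τ * Yl)) := div_nonneg (by positivity) (sub_nonneg.2 hy.le)
  have hbr := readoutBracket_le_law_mul_sharp hAro0 hQro0 hA'0 hQ'0 hψ hτ hx10 hTY hYy hCinc0.le hDinc1 (by omega : 1 ≤ p)
  have hfin : klLevNormOf L M β μ K j (2 * p) (klEffectiveAction L M β U μ K klE0 j) Ωe / klLevUnitF β M t p j ≤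
      Atot * (B * epsCoupling P U j) ^ (p - 1) * Qtot ^ p := by
    refine hfit.trans ?_
    rw [hAtot, hQtot]
    calc lam ^ (p - 1) * (Aro * Qro ^ p + (27 : ℝ) ^ 5 * (C₁' / C₂') * (max 1 (C₂' ^ 2)) ^ p *
            (A' * (4 * Q') ^ p * (4 * σ * lam * Q' / (1 - 4 * σ * lam * Q')) +
              exp 1 * ψ * (2 * τ * ψ * Q') ^ (p - 1) * (τ * Yl) * (Φ * (τ * Yl) / (1 - Φ * (τ * Yl)))))
        ≤ lam ^ (p - 1) * ((Aro + (27 : ℝ) ^ 5 * (C₁' / C₂') * (A' * (4 * σ * lam * Q' / (1 - 4 * σ * lam * Q')) +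
              exp 1 * (τ * Yl) * (Φ * (τ * Yl) / (1 - Φ * (τ * Yl))) / (2 * τ * Q'))) *
            (max 1 (C₂' ^ 2) * max 1 (max Qro (max (4 * Q') (2 * τ * ψ * Q')))) ^ p) :=
          mul_le_mul_of_nonneg_left hbr (by positivity)
      _ = (Aro + (27 : ℝ) ^ 5 * (C₁' / C₂') * (A' * (4 * σ * lam * Q' / (1 - 4 * σ * lam * Q')) +
              exp 1 * (τ * Yl) * (Φ * (τ * Yl) / (1 - Φ * (τ * Yl))) / (2 * τ * Q'))) *
            lam ^ (p - 1) * (max 1 (C₂' ^ 2) * max 1 (max Qro (max (4 * Q') (2 * τ * ψ * Q')))) ^ p := by ring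
  have hAtot0 : 0 ≤ Atot := by rw [hAtot]; positivity
  have hQtot0 : 0 ≤ Qtot := by
    rw [hQtot]; exact mul_nonneg hDinc0.le (zero_le_one.trans (le_max_left _ _))
  exact readoutLev_le_levelsRHS hβ hKl U hAtot0 hQtot0 hB hCE t (by omega) j hfin

end Summit.HubbardSuperconductivity.HubbardSuperconductivity.Theorems.EngineV8

end
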